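import Literature.Probability.Percolation.InterfaceLoopClusters
import Literature.Probability.Percolation.FKFreeLoopRepresentation
import HarnessLib

/-!
# The outer boundary loop of a finite open cluster of `ℤ²`

Topic: Probability / Percolation (loops ↔ clusters dictionary for the loop representation of
critical bond percolation on `ℤ²`: Duminil-Copin–Kozlowski–Krachun–Manolescu–Oulamara,
arXiv:2012.11672v2 (2026), §1.2, "a loop is in `F₁` if it is the exterior boundary of a primal
cluster"; Grimmett, *Percolation* (1999), §11.2; Camia–Newman, Comm. Math. Phys. 268 (2006),
§4).

**Theorem** (`exists_isInterfaceLoop_around_openCluster`). Let `ω ⊆ E(ℤ²)` be a bond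
configuration and let the open cluster `C = openCluster ω x` be finite. Then there is an
interface loop `γ` of `ω` (`IsInterfaceLoop ω γ`) of type `1` (`loopType γ = 1`,
counter-clockwise) such that

* some dart of `γ` has its left vertex in `C` (so the whole rim of `γ` lies in `C`,
  `IsInterfaceLoop.reachable_left`),
* every vertex of `C` has winding number `1` with respect to `γ` (the loop surrounds the
  cluster: `C` lies inside),
* every point of the trace of `γ` (mesh `1`) is within distance `1/2` of a vertex of `C`.

This is the loop of `F₁` attached to the cluster `C` in DKKMO's typing: its exterior boundary.

## Proof

Take a lowest vertex `v⋆` of `C` (minimal second coordinate) and the corner `p⋆ = (v⋆, 3)`,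
whose face is the face below-right of `v⋆`. The orbit of `p⋆` under Smirnov's successor map
`nextCorner ω` keeps its left vertex in `C` (`reachable_iterate_nextCorner`), a finite set, so
`p⋆` is periodic and its cycle is an interface loop `γ = orbitLoop ω p⋆`
(`FKFreeLoopRepresentation`: `mem_periodicPts_nextCorner_of_finite`, `isInterfaceLoop_orbitLoop`).
The trace of `γ` stays within `1/2` of its rim (`IsInterfaceLoop.exists_reachable_dist_le`),
which lies in `C`, hence in the closed half-plane `im ≥ v⋆₁ - 1/2`; the centre `c` of the face of
`p⋆` has `im c = v⋆₁ - 1/2` and is off the trace, so the downward vertical ray from `c` misses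
the trace and `W(c) = 0` (`CurveClass.wind_eq_of_segment_disjoint`, `wind_eq_zero_of_subset_ball`).
By the jump relation `W(v⋆) = W(c) + 1 = 1`, so `γ` has type `1` (`IsInterfaceLoop.wind_left_eq`)
and `W = 1` on the whole cluster (`IsInterfaceLoop.wind_eq_of_mem_openCluster`).

## References

* H. Duminil-Copin, K. K. Kozlowski, D. Krachun, I. Manolescu, M. Oulamara, arXiv:2012.11672v2
  (2026), §1.2 [arXiv201211672v2].
* G. Grimmett, *Percolation*, 2nd ed. (1999), §11.2 [Grimmett1999].
* F. Camia, C. M. Newman, Comm. Math. Phys. 268 (2006), §4 [CamiaNewman2006].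
-/

noncomputable section

open Set Metric Function

namespace Literature.Probability.Percolation

open LatticeModels RandomPlanarGeometry

/-- The orbit of a corner keeps its left vertex in the open cluster of the starting vertex.
[cite: Smirnov2001, §2] -/
theorem iterate_nextCorner_fst_mem_openCluster (ω : BondConfig (Site 2)) (p : Site 2 × Fin 4)
    (m : ℕ) : ((nextCorner ω)^[m] p).1 ∈ openCluster ω p.1 :=
  reachable_iterate_nextCorner ω p m

/-- **A corner with left vertex in a finite open cluster is periodic** under the successor map
(its orbit stays in the finite set of corners over the cluster, and the successor map is
injective). [cite: Smirnov2001, §2] -/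
theorem mem_periodicPts_nextCorner_of_finite_openCluster {ω : BondConfig (Site 2)}
    {p : Site 2 × Fin 4} (hfin : (openCluster ω p.1).Finite) : p ∈ periodicPts (nextCorner ω) := by
  refine mem_periodicPts_nextCorner_of_finite (S := {c | c.1 ∈ openCluster ω p.1})
    ((hfin.prod (Set.finite_univ (α := Fin 4))).subset ?_) fun m ↦ ?_
  · rintro ⟨v, k⟩ hv
    exact ⟨hv, Set.mem_univ _⟩
  · exact iterate_nextCorner_fst_mem_openCluster ω p m

/-- The imaginary part of a lattice point at mesh `1` is its second coordinate. [folklore] -/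
theorem im_meshPoint_one (v : Site 2) : (meshPoint 1 v).im = v 1 := by simp

/-- A point within distance `1/2` of a lattice point is at most `1/2` below it. [folklore] -/
theorem im_sub_half_le_of_dist_le {z : ℂ} {v : Site 2} (h : dist z (meshPoint 1 v) ≤ 1 / 2) :
    (v 1 : ℝ) - 1 / 2 ≤ z.im := by
  have h1 : |z.im - (meshPoint 1 v).im| ≤ dist z (meshPoint 1 v) := by
    rw [Complex.dist_eq, ← Complex.sub_im]
    exact Complex.abs_im_le_norm _
  rw [im_meshPoint_one] at h1
  have := (abs_le.1 (h1.trans h)).1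
  linarith

/-- **The outer boundary loop of a finite open cluster** (DKKMO's `F₁`-loop of the cluster). For
a configuration `ω ⊆ E(ℤ²)` and a finite open cluster `C = openCluster ω x` there is an
interface loop `γ` of `ω` of type `1` with a dart whose left vertex lies in `C`, such that every
vertex of `C` has winding number `1` (the cluster is inside the loop) and every point of the
trace is within `1/2` of a vertex of `C`. ("A loop is in `F₁` if it is the exterior boundary of a
primal cluster", DKKMO arXiv:2012.11672v2, §1.2; Grimmett 1999, §11.2; Camia–Newman 2006, §4.)
[cite: arXiv201211672v2, §1.2] -/
theorem exists_isInterfaceLoop_around_openCluster {ω : BondConfig (Site 2)}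
    (hω : ω ⊆ (zdGraph 2).edgeSet) {x : Site 2} (hfin : (openCluster ω x).Finite) :
    ∃ γ : List MedialVertex, IsInterfaceLoop ω γ ∧ loopType γ = 1 ∧
      (∃ p : Site 2 × Fin 4, (cSrc p, cTgt p) ∈ γ.zip (γ.rotate 1) ∧ p.1 ∈ openCluster ω x) ∧
      (∀ y ∈ openCluster ω x, (loopCurve 1 0 γ).wind (meshPoint 1 y) = 1) ∧
      (∀ z ∈ (loopCurve 1 0 γ).range, ∃ y ∈ openCluster ω x, dist z (meshPoint 1 y) ≤ 1 / 2) := by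
  classical
  -- a lowest vertex of the cluster
  obtain ⟨v, hvC, hvmin⟩ := hfin.toFinset.exists_min_image (fun w : Site 2 ↦ w 1)
    ⟨x, hfin.mem_toFinset.2 (mem_openCluster_self ω x)⟩
  rw [Set.Finite.mem_toFinset] at hvC
  have hvmin' : ∀ w ∈ openCluster ω x, v 1 ≤ w 1 := fun w hw ↦ hvmin w (hfin.mem_toFinset.2 hw)
  -- the cluster of `v` is the cluster of `x`
  have hCv : openCluster ω v = openCluster ω x := by
    ext w
    exact ⟨fun hw ↦ SimpleGraph.Reachable.trans hvC hw, fun hw ↦ SimpleGraph.Reachable.trans hvC.symm hw⟩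
  -- the start corner: the face below-right of `v`
  set p : Site 2 × Fin 4 := (v, 3) with hpdef
  have hp1 : p.1 = v := rfl
  have hper : p ∈ periodicPts (nextCorner ω) :=
    mem_periodicPts_nextCorner_of_finite_openCluster (by rw [hp1, hCv]; exact hfin)
  set γ := orbitLoop ω p with hγdef
  have hγ : IsInterfaceLoop ω γ := isInterfaceLoop_orbitLoop hper
  have hpγ : (cSrc p, cTgt p) ∈ γ.zip (γ.rotate 1) := (mem_darts_orbitLoop_iff hper).2 ⟨0, rfl⟩
  -- localisation of the trace near the cluster
  have hloc : ∀ z ∈ (loopCurve 1 0 γ).range, ∃ y ∈ openCluster ω x, dist z (meshPoint 1 y) ≤ 1 / 2 := by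
    intro z hz
    obtain ⟨y, hy, hdist⟩ := hγ.exists_reachable_dist_le hpγ hz
    refine ⟨y, ?_, hdist⟩
    rw [← hCv]
    exact hy.mono inf_le_left
  -- the trace lies in the half-plane `im ≥ v 1 - 1/2`
  have him : ∀ z ∈ (loopCurve 1 0 γ).range, (v 1 : ℝ) - 1 / 2 ≤ z.im := by
    intro z hz
    obtain ⟨y, hy, hdist⟩ := hloc z hz
    have h1 := im_sub_half_le_of_dist_le hdist
    have h2 : (v 1 : ℝ) ≤ y 1 := by exact_mod_cast hvmin' y hy
    linarith
  -- the centre of the face of `p` and the downward ray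
  set c : ℂ := faceCenter (cFace p) with hcdef
  have hcim : c.im = (v 1 : ℝ) - 1 / 2 := by
    rw [hcdef, hpdef, faceCenter_im, cFace, faceAt]
    simp [cornerOff]
    ring
  have hc_off : c ∉ (loopCurve 1 0 γ).range := by
    intro hc
    have h1 := hγ.le_infDist_faceCenter (cFace p)
    rw [Metric.infDist_zero_of_mem hc] at h1
    have : (0 : ℝ) < Real.sqrt 2 / 4 := by positivity
    linarith
  -- a far point below `c`
  obtain ⟨ρ, hρpos, hρ⟩ : ∃ ρ : ℝ, 0 < ρ ∧ (loopCurve 1 0 γ).range ⊆ ball c ρ := by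
    obtain ⟨ρ, hρ⟩ := (loopCurve 1 0 γ).isCompact_range.isBounded.subset_ball c
    exact ⟨max ρ 1, by positivity, hρ.trans (ball_subset_ball (le_max_left _ _))⟩
  set q : ℂ := c - (ρ : ℂ) * Complex.I with hqdef
  have hq0 : (loopCurve 1 0 γ).wind q = 0 := by
    refine (loopCurve 1 0 γ).wind_eq_zero_of_subset_ball hρ ?_
    rw [hqdef, dist_eq_norm]
    simp [Complex.norm_I, abs_of_pos hρpos]
  -- the segment `[c, q]` misses the trace
  have hdisj : Disjoint (segment ℝ c q) (loopCurve 1 0 γ).range := by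
    rw [Set.disjoint_left]
    intro z hz hzr
    rw [segment_eq_image'] at hz
    obtain ⟨t, ⟨ht0, ht1⟩, rfl⟩ := hz
    rcases eq_or_lt_of_le ht0 with rfl | ht0'
    · simp at hzr
      exact hc_off hzr
    · have h1 := him _ hzr
      have h2 : (c + t • (q - c)).im = (v 1 : ℝ) - 1 / 2 - t * ρ := by
        rw [hqdef, Complex.add_im, Complex.smul_im, hcim]
        simp
        ring
      rw [h2] at h1
      have : 0 < t * ρ := mul_pos ht0' hρpos
      linarith
  have hc0 : (loopCurve 1 0 γ).wind c = 0 := by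
    rw [(loopCurve 1 0 γ).wind_eq_of_segment_disjoint (isLoop_loopCurve 1 0 hγ.ne_nil) hdisj, hq0]
  -- the jump relation at `p`: `W(v) = W(c) + 1 = 1`, so the loop has type `1`
  have hv1 : (loopCurve 1 0 γ).wind (meshPoint 1 v) = 1 := by
    have := hγ.wind_sub_wind_cFace p
    rw [if_pos hpγ, hp1, ← hcdef, hc0] at this
    omega
  have htype : loopType γ = 1 := by
    have hl := hγ.wind_left_eq hpγ
    rw [hp1, hv1] at hl
    by_contra hne
    rw [if_neg hne] at hl
    exact one_ne_zero hl
  refine ⟨γ, hγ, htype, ⟨p, hpγ, by rw [hp1]; exact hvC⟩, fun y hy ↦ ?_, hloc⟩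
  rw [← hCv] at hy
  rw [← hγ.wind_eq_of_mem_openCluster hω hy, hv1]

end Literature.Probability.Percolation

end
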